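import Literature.Algebra.EuclideanLattices.NearestPlaneGaussian
import HarnessLib

/-!
# Babai's nearest-plane algorithm recovers the closest vector below half the Gram–Schmidt minimum

Topic `Algebra/EuclideanLattices` (family `pqc`), namespace `Babai`. Everything here is PROVED: one
definition with body (`Babai.nearestPlane`, the deterministic recursion on coefficient vectors, built on
the bookkeeping of `NearestPlaneGaussian.lean` — `GPVSampler.lastCenter`, `GPVSampler.vecOf`) and its
exact-recovery guarantee; no named fact.

**Babai 1986, §3, procedure NEAREST PLANE** (for a basis `b₁,…,bₙ` and a target `c`): find the integer
`z` for which the affine hyperplane `z bₙ + span(b₁,…,b_{n-1})` is nearest to `c`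
(`z = ⌊⟪c, b̃ₙ⟫/‖b̃ₙ‖²⌉`), recurse on `c - z bₙ` in dimension `n - 1`. Babai proves an approximation
factor `2^{n/2}` for LLL-reduced bases (Thm. 3.1); the elementary EXACT-RECOVERY regime proved here —
if `c = ∑ aᵢbᵢ + e` with `|⟪e, b̃ᵢ⟫| < ‖b̃ᵢ‖²/2` for all `i` (e.g. `‖e‖ < minᵢ‖b̃ᵢ‖/2`) then the output
is exactly `a` — is the property used downstream: it is the final step of Regev 2009, Lemma 3.5
("we now apply an algorithm for approximately solving the closest vector problem, such as Babai's
nearest plane algorithm", after the digit recursion of `RegevDigitRecursion.lean` has shrunk the distance)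
inside Lemma 3.4 = Peikert's Prop. 3.2 (hypothesis `h₂` of
`Literature.Computability.Cryptography.peikert_gapSVPZeta_to_lwe_classical_of_components`, pqc.S20, where
the `GapSVP_{ζ,γ}` promise `minᵢ‖b̃ᵢ‖ ≥ 1` makes the regime explicit), and GPV's `SampleD`
(`NearestPlaneGaussian.lean`) is its randomised-rounding variant.

## Results

* `Babai.nearestPlane k f c : Fin k → ℤ` — the algorithm on coefficient vectors (last coefficient first,
  `Fin.snoc`), `nearestPlane_succ`.
* `Babai.lastCenter_vecOf_add` — `⟪∑aᵢbᵢ + e, b̃_last⟫/‖b̃_last‖² = a_last + ⟪e, b̃_last⟫/‖b̃_last‖²`.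
* `Babai.nearestPlane_vecOf_add` — **exact recovery**: `nearestPlane f (∑ aᵢbᵢ + e) = a` when
  `|⟪e, b̃ᵢ⟫| < ‖b̃ᵢ‖²/2` for all `i`; `Babai.nearestPlane_vecOf_add_of_norm_lt` — the same from
  `‖e‖ < ‖b̃ᵢ‖/2` (Cauchy–Schwarz); `Babai.vecOf_mem_span` (outputs are lattice vectors).

## References

* L. Babai, *On Lovász' lattice reduction and the nearest lattice point problem*, Combinatorica 6
  (1986) 1–13, §3 (nearest plane procedure), Thm. 3.1 [Babai1986].
* O. Regev, *On lattices, learning with errors, random linear codes, and cryptography*, J. ACM 56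
  (2009), Lemma 3.5 (proof) [RegevLWE2009].
* C. Gentry, C. Peikert, V. Vaikuntanathan, STOC 2008, §4.2 (SampleD = randomised nearest plane)
  [GentryPeikertVaikuntanathan2008].
-/

noncomputable section

open Finset InnerProductSpace Real
open scoped RealInnerProductSpace

namespace Literature.Algebra.EuclideanLattices

variable {V : Type*} [NormedAddCommGroup V] [InnerProductSpace ℝ V]

namespace Babai

open GPVSampler

/-- **Babai's nearest-plane algorithm** (Babai 1986, §3 "Procedure NEAREST PLANE"; the deterministic
version of GPV's `SampleD`, which "is Babai's nearest plane algorithm with randomised rounding"): for the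
family `f = (b₀, …, b_{k-1})` and a target `c`, take the LAST coefficient `z_{k-1} = ⌊⟪c, b̃_{k-1}⟫/‖b̃_{k-1}‖²⌉`
(the index of the nearest hyperplane `z·b_{k-1} + span(b₀,…,b_{k-2})`), then recurse on
`c - z_{k-1} b_{k-1}` with the family `(b₀, …, b_{k-2})`. Output: the coefficient vector `z`; the lattice
vector is `vecOf f z = ∑ zᵢbᵢ`. [cite: Babai1986, §3 (nearest plane procedure)] -/
def nearestPlane : (k : ℕ) → (Fin k → V) → V → (Fin k → ℤ)
  | 0, _, _ => fun i => i.elim0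
  | k + 1, f, c =>
      Fin.snoc (nearestPlane k (f ∘ Fin.castSucc) (c - (round (lastCenter f c) : ℝ) • f (Fin.last k)))
        (round (lastCenter f c))

/-- Unfolding of one step. [cite: Babai1986, §3] -/
theorem nearestPlane_succ {k : ℕ} (f : Fin (k + 1) → V) (c : V) :
    nearestPlane (k + 1) f c =
      Fin.snoc (nearestPlane k (f ∘ Fin.castSucc) (c - (round (lastCenter f c) : ℝ) • f (Fin.last k)))
        (round (lastCenter f c)) := rfl

/-- The centre of the last coefficient of `∑ aᵢbᵢ + e` is `a_last + ⟪e, b̃_last⟫/‖b̃_last‖²`.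
[cite: Babai1986, §3] -/
theorem lastCenter_vecOf_add {k : ℕ} (f : Fin (k + 1) → V) (a : Fin (k + 1) → ℤ) (e : V)
    (hf : gramSchmidt ℝ f (Fin.last k) ≠ 0) :
    lastCenter f (vecOf f a + e) =
      (a (Fin.last k) : ℝ) + ⟪e, gramSchmidt ℝ f (Fin.last k)⟫ / ‖gramSchmidt ℝ f (Fin.last k)‖ ^ 2 := by
  have hn : ‖gramSchmidt ℝ f (Fin.last k)‖ ^ 2 ≠ 0 := pow_ne_zero 2 (norm_ne_zero_iff.2 hf)
  have h0 : lastCenter f (0 : V) = 0 := by simp [lastCenter]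
  have h := inner_vecOf_sub_gramSchmidt_last f 0 a hf
  rw [sub_zero, h0, sub_zero] at h
  rw [lastCenter, inner_add_left, h]
  field_simp

/-- **Babai's guarantee, exact-recovery regime** (Babai 1986, §3/§4; the fact used by Regev 2009,
Lemma 3.5, and by Peikert 2009: when the error is shorter than half of every Gram–Schmidt vector the
nearest-plane algorithm returns THE closest vector). If `c = ∑ aᵢbᵢ + e` with
`|⟪e, b̃ᵢ⟫| < ‖b̃ᵢ‖²/2` for every `i` (all `b̃ᵢ ≠ 0`), then `nearestPlane f c = a`. Proof by induction on
the dimension: the last centre is `a_last + ⟪e, b̃_last⟫/‖b̃_last‖²` with the fraction in `(-½, ½)`,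
so it rounds to `a_last`; the recursive call sees `∑_{i<last} aᵢbᵢ + e` and the prefix family, whose
Gram–Schmidt vectors are the same (`gramSchmidt_comp_castSucc`). [cite: Babai1986, §3 (nearest plane procedure) and Thm. 3.1] -/
theorem nearestPlane_vecOf_add : ∀ (k : ℕ) (f : Fin k → V) (_ : ∀ i, gramSchmidt ℝ f i ≠ 0)
    (a : Fin k → ℤ) (e : V)
    (_ : ∀ i, |⟪e, gramSchmidt ℝ f i⟫| < ‖gramSchmidt ℝ f i‖ ^ 2 / 2),
    nearestPlane k f (vecOf f a + e) = a
  | 0, f, _, a, e, _ => funext fun i => i.elim0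
  | k + 1, f, hf, a, e, he => by
      have hfl := hf (Fin.last k)
      have hn : 0 < ‖gramSchmidt ℝ f (Fin.last k)‖ ^ 2 := pow_pos (norm_pos_iff.2 hfl) 2
      -- the last coefficient rounds to `a_last`
      have hround : round (lastCenter f (vecOf f a + e)) = a (Fin.last k) := by
        rw [lastCenter_vecOf_add f a e hfl, round_intCast_add, add_eq_left, round_eq_zero_iff]
        have h := he (Fin.last k)
        rw [abs_lt] at h
        constructor
        · rw [le_div_iff₀ hn]; linarith
        · rw [div_lt_iff₀ hn]; linarith
      -- the recursive call
      have hprefix : ∀ i : Fin k, gramSchmidt ℝ (f ∘ Fin.castSucc) i = gramSchmidt ℝ f (Fin.castSucc i) :=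
        fun i => Literature.Analysis.InnerProduct.gramSchmidt_comp_castSucc ℝ f i
      have hf' : ∀ i : Fin k, gramSchmidt ℝ (f ∘ Fin.castSucc) i ≠ 0 := fun i => by
        rw [hprefix]; exact hf _
      have he' : ∀ i : Fin k, |⟪e, gramSchmidt ℝ (f ∘ Fin.castSucc) i⟫| <
          ‖gramSchmidt ℝ (f ∘ Fin.castSucc) i‖ ^ 2 / 2 := fun i => by
        rw [hprefix]; exact he _
      have hrec : vecOf f a + e - (a (Fin.last k) : ℝ) • f (Fin.last k) =
          vecOf (f ∘ Fin.castSucc) (Fin.init a) + e := by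
        rw [vecOf_succ]; abel
      rw [nearestPlane_succ, hround, hrec,
        nearestPlane_vecOf_add k (f ∘ Fin.castSucc) hf' (Fin.init a) e he', Fin.snoc_init_self]

/-- **Norm form of the hypothesis**: `‖e‖ < ‖b̃ᵢ‖/2` for all `i` implies `|⟪e, b̃ᵢ⟫| < ‖b̃ᵢ‖²/2`
(Cauchy–Schwarz), hence exact recovery: `nearestPlane f (∑ aᵢbᵢ + e) = a`. In particular Babai's
algorithm solves `CVP` exactly whenever `dist(target, L(B)) < minᵢ ‖b̃ᵢ‖/2` — the final step of Regev's
Lemma 3.5 ("we now apply an algorithm for approximately solving the closest vector problem, such as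
Babai's nearest plane algorithm") once the recursion has made the distance small. [cite: Babai1986, §3; RegevLWE2009, Lemma 3.5 (proof)] -/
theorem nearestPlane_vecOf_add_of_norm_lt {k : ℕ} (f : Fin k → V) (hf : ∀ i, gramSchmidt ℝ f i ≠ 0)
    (a : Fin k → ℤ) (e : V) (he : ∀ i, ‖e‖ < ‖gramSchmidt ℝ f i‖ / 2) :
    nearestPlane k f (vecOf f a + e) = a := by
  refine nearestPlane_vecOf_add k f hf a e fun i => ?_
  have hpos : 0 < ‖gramSchmidt ℝ f i‖ := norm_pos_iff.2 (hf i)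
  calc |⟪e, gramSchmidt ℝ f i⟫| ≤ ‖e‖ * ‖gramSchmidt ℝ f i‖ := abs_real_inner_le_norm _ _
    _ < ‖gramSchmidt ℝ f i‖ / 2 * ‖gramSchmidt ℝ f i‖ := mul_lt_mul_of_pos_right (he i) hpos
    _ = ‖gramSchmidt ℝ f i‖ ^ 2 / 2 := by ring

/-- The output is always a coefficient vector of the lattice `L(f)`: `vecOf f (nearestPlane f c) ∈ span_ℤ f`.
[cite: Babai1986, §3] -/
theorem vecOf_mem_span {k : ℕ} (f : Fin k → V) (z : Fin k → ℤ) :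
    vecOf f z ∈ Submodule.span ℤ (Set.range f) := by
  unfold vecOf
  refine Submodule.sum_mem _ fun i _ => ?_
  rw [Int.cast_smul_eq_zsmul ℝ]
  exact Submodule.smul_mem _ _ (Submodule.subset_span ⟨i, rfl⟩)

end Babai

end Literature.Algebra.EuclideanLattices
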